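import Summits.ResolutionOfSingularities.ResolutionOfSingularities.Theses.FrobeniusClosing
import Literature.AlgebraicGeometry.CossartPiltant200819.Thm21ProjectiveMorphisms2008
import Literature.AlgebraicGeometry.Resolution.QuasiExcellentSchemes
import Literature.AlgebraicGeometry.Resolution.Blowups
import Literature.AlgebraicGeometry.Resolution.BlowupsComposition
import Literature.AlgebraicGeometry.Resolution.BlowupsFlatBaseChange
import Literature.AlgebraicGeometry.Resolution.Temkin2008Localization
import Literature.AlgebraicGeometry.Resolution.Principalization
import HarnessLib

/-!
# Crux `PatchingRelPerfect` (stmt-ResolutionOfSingularities-16161), line `closed-point-slice`,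
stub `stub_printedInputs`: the CJS conjunct DE-VENDORED

[OURS · L1 W5.2] Support file for the registered stub `stub_printedInputs` of the skeleton
`Cruxes/PatchingRelPerfect/Lines/closed_point_slice.lean` (sha `d8599e35`), whose signature is the
conjunction

  `CossartPiltant2019General.{0} ∧ CossartPiltant2019Principalization.{0} ∧`
  `∀ X [IsNoetherian X] [IsReduced X], Scheme.IsExcellent X → topologicalKrullDim X ≤ 2 →`
  `Scheme.AdmitsDesingularization X`.

The first two conjuncts are EXISTING named facts of the tree (Cossart–Piltant 2019, Thm. 1.1 and
Prop. 4.4; Lean formalisation debt of size XL, carried as the crux item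
`CleanCovers.PrintedResolutionDimLeThree` = stmt-ResolutionOfSingularities-19706).  The third
conjunct — Cossart–Jannsen–Saito 2020 Thm. 1.2 *in Temkin's single-blow-up format* — was so
far an ad-hoc restatement ("vendored").  This file DERIVES it from the tree's rendering of
the printed theorem WITH its blow-up structure, `CossartJannsenSaito2020Sequence` (a resolution
which is a finite `IsSingularBlowupSequence`: successive blow-ups in centres inside the singular
loci), by
collapsing such a sequence on a Noetherian scheme to ONE blowing up along an ideal sheaf
cosupported in the singular locus (Raynaud / Stacks 080B, tree lemma
`IsBlowup.exists_isBlowup_comp_supported`, plus the transport of regularity across the open where a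
blow-up is an isomorphism).

Main results:
* `exists_isBlowup_singSupported_of_isSingularBlowupSequence` — the collapse;
* `admitsDesingularization_of_isSingularBlowupSequence` — a singular blow-up sequence with regular
  end is a desingularization in Temkin's sense (Def. 2.2.6);
* `cjs2020BlowupFormat_of_cossartJannsenSaito2020Sequence` — the third conjunct of the stub from
  the named fact;
* `stub_printedInputs_of_namedFacts` — the registered stub VERBATIM, modulo exactly the three
  named facts `CossartPiltant2019General`, `CossartPiltant2019Principalization`,
  `CossartJannsenSaito2020Sequence` (conditional result; nothing else is assumed).

## Sources

* V. Cossart, U. Jannsen, S. Saito, *Desingularization: invariants and strategy*, LNM 2270 (2020),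
  Introduction Thm. 1 / Thm. 1.2. [CossartJannsenSaito2020]
* M. Temkin, *Desingularization of quasi-excellent schemes in characteristic zero*, Adv. Math. 219
  (2008), Def. 2.2.6, Lemma 2.1.4. [Temkin2008]
* The Stacks Project, Tag 080B (composition of blowing ups), Tag 02OS. [StacksProject]
* V. Cossart, O. Piltant, J. Algebra 529 (2019), Thm. 1.1, Prop. 4.4. [CossartPiltant2019]
-/

noncomputable section

open CategoryTheory AlgebraicGeometry TopologicalSpace
open Literature.AlgebraicGeometry.Resolution

set_option linter.dupNamespace false

namespace Summit.ResolutionOfSingularities.ResolutionOfSingularities.Theorems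

universe u

/-- **A blow-up in a singular centre does not create regular points over regular points it
moved**: if `π : X' ⟶ X` is a blow-up along `J` with `Supp J ⊆ Sing X`, then every point of
`X'` lying over a regular point of `X` is a regular point of `X'` (over `X ∖ Supp J ⊇ Reg X` the
map `π` is an isomorphism, `IsBlowup.isIso_compl`, so the local rings agree). Contrapositive form:
`π` maps `Sing X'` into `Sing X`. [folklore] -/
theorem singularLocus_subset_preimage_of_isBlowup_singSupported {X' X : Scheme.{u}} {π : X' ⟶ X}
    {J : X.IdealSheafData} (hπ : IsBlowup π J)
    (hJ : (J.support : Set X) ⊆ (Scheme.regularLocus X)ᶜ) :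
    (Scheme.regularLocus X')ᶜ ⊆ π.base ⁻¹' (Scheme.regularLocus X)ᶜ := by
  intro x' hx'
  simp only [Set.mem_preimage, Set.mem_compl_iff] at hx' ⊢
  intro hx
  have hxJ : π.base x' ∉ (J.support : Set X) := fun h => hJ h hx
  let U : X.Opens := ⟨(J.support : Set X)ᶜ, J.support.isClosed.isOpen_compl⟩
  haveI : IsIso (π ∣_ U) := hπ.isIso_compl
  exact hx' ((mem_regularLocus_iff_of_isIso_morphismRestrict π U x' hxJ).mpr hx)

/-- **Collapse of a singular blow-up sequence** (Raynaud; Stacks 080B; Temkin 2008, Lemma 2.1.4):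
on a Noetherian scheme `X`, a finite sequence of blowing ups, each in a centre contained in the
singular locus of the current stage, is ONE blowing up of `X` along an ideal sheaf whose cosupport
is contained in the singular locus `X ∖ Reg X` (the empty sequence is the blow-up along the unit
ideal). [cite: StacksProject, Tag 080B] [cite: Temkin2008, Lemma 2.1.4] -/
theorem exists_isBlowup_singSupported_of_isSingularBlowupSequence
    {X' X : Scheme.{u}} {π : X' ⟶ X} (h : IsSingularBlowupSequence π) (hX : IsNoetherian X) :
    ∃ J : X.IdealSheafData, IsBlowup π J ∧
      (J.support : Set X) ⊆ (Scheme.regularLocus X)ᶜ := by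
  induction h with
  | id X =>
    exact ⟨⊤, isBlowup_id_top X, by simp [Scheme.IdealSheafData.support_top]⟩
  | @comp X'' X' X σ π D hσ hD hπ ih =>
    haveI : IsNoetherian X := hX
    obtain ⟨J, hJ, hJsupp⟩ := ih hX
    obtain ⟨Q, hQ, hQsupp⟩ := IsBlowup.exists_isBlowup_comp_supported π J σ D
      (Scheme.regularLocus X)ᶜ hJ hJsupp hσ
      (hD.trans (singularLocus_subset_preimage_of_isBlowup_singSupported hJ hJsupp))
    exact ⟨Q, hQ, hQsupp⟩

/-- **A singular blow-up sequence with regular end is a desingularization** in the sense of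
Temkin 2008, Def. 2.2.6 (one `X_reg`-admissible blowing up with regular source), for `X`
Noetherian. [cite: Temkin2008, Def. 2.2.6 (i), Lemma 2.1.4] -/
theorem admitsDesingularization_of_isSingularBlowupSequence {X' X : Scheme.{u}} {π : X' ⟶ X}
    [IsNoetherian X] (h : IsSingularBlowupSequence π) (hreg : Scheme.IsRegular X') :
    Scheme.AdmitsDesingularization X := by
  obtain ⟨J, hJ, hsupp⟩ :=
    exists_isBlowup_singSupported_of_isSingularBlowupSequence h ‹IsNoetherian X›
  exact ⟨X', π, ⟨J, hJ, hsupp⟩, hreg⟩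

/-- **Cossart–Jannsen–Saito 2020, Thm. 1.2, in Temkin's single-blow-up format, FROM the named
fact with blow-up structure**: for every reduced excellent Noetherian scheme `X` of dimension
`≤ 2`, `X` admits a desingularization (one blowing up along an ideal sheaf cosupported in
`Sing X`, with regular source). This is the third conjunct of the registered stub
`stub_printedInputs` of crux `PatchingRelPerfect`, no longer vendored.
[cite: CossartJannsenSaito2020, Thm. 1.2] [cite: Temkin2008, Lemma 2.1.4] -/
theorem cjs2020BlowupFormat_of_cossartJannsenSaito2020Sequence
    (h : CossartJannsenSaito2020Sequence.{u}) :
    ∀ (X : Scheme.{u}) [IsNoetherian X] [IsReduced X], Scheme.IsExcellent X →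
      topologicalKrullDim X ≤ 2 → Scheme.AdmitsDesingularization X := by
  intro X _ _ hX hdim
  obtain ⟨X', π, hres, hseq, -⟩ := h X hX hdim
  exact admitsDesingularization_of_isSingularBlowupSequence hseq hres.isRegular

/-- **The registered stub `stub_printedInputs` (crux `PatchingRelPerfect`, line
`closed-point-slice`, skeleton sha `d8599e35`) VERBATIM, modulo exactly three NAMED FACTS of the
tree**: Cossart–Piltant 2019 Thm. 1.1 (`CossartPiltant2019General`), Prop. 4.4
(`CossartPiltant2019Principalization`) and Cossart–Jannsen–Saito 2020 Thm. 1.2 with its blow-up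
structure (`CossartJannsenSaito2020Sequence`). CONDITIONAL result: the three hypotheses are
printed theorems not yet formalised (item stmt-ResolutionOfSingularities-19706 carries (i)–(ii));
the point of this lemma is that NOTHING ELSE is vendored by the stub.
[cite: CossartPiltant2019, Thm. 1.1 and Prop. 4.4] [cite: CossartJannsenSaito2020, Thm. 1.2] -/
theorem stub_printedInputs_of_namedFacts (hG : CossartPiltant2019General.{0})
    (hP : CossartPiltant2019Principalization.{0}) (hS : CossartJannsenSaito2020Sequence.{0}) :
    CossartPiltant2019General.{0} ∧ CossartPiltant2019Principalization.{0} ∧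
    ∀ (X : Scheme.{0}) [IsNoetherian X] [IsReduced X], Scheme.IsExcellent X →
      topologicalKrullDim X ≤ 2 → Scheme.AdmitsDesingularization X :=
  ⟨hG, hP, cjs2020BlowupFormat_of_cossartJannsenSaito2020Sequence hS⟩

end Summit.ResolutionOfSingularities.ResolutionOfSingularities.Theorems

end
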